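import Mathlib
import HarnessLib
import Summits.HubbardSuperconductivity.HubbardSuperconductivity.Theses.FunctionFieldCertificate
import Summits.HubbardSuperconductivity.HubbardSuperconductivity.Theses.KacWindowPenalty
import Summits.HubbardSuperconductivity.HubbardSuperconductivity.Theorems.AposterioriCapRgSsbToEvenTorusLroWindowLatticeSum
import Literature.MathematicalPhysics.QuantumLattice.PairFieldMomentum
import Literature.MathematicalPhysics.QuantumLattice.PairCorrelationsProofs

/-!
# Crux `WindowInfraredBound` (stmt-HubbardSuperconductivity-1089) — reductions I: tree vocabulary,
# the a-priori (Parseval) ceiling, and the Goldstone-shape reduction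

Item stmt-HubbardSuperconductivity-1089 is the crux `WindowInfraredBound`, stated verbatim in the two routes
`FunctionFieldCertificate` (rank 4) and `KacWindowPenalty` (rank 3):

  for all `U > 0`, `δ ∈ (0, 1/2)` there are `C ≥ 0`, `ε₀ > 0`, `L₀` such that for all `ε ∈ (0, ε₀]`, all
  even `L ≥ L₀` and every normalised `(N_L, S^z = 0)`-sector ground state `ψ` of `hubbardTorus 2 L 1 U`,
  `N_L = 2⌊(1-δ)L²/2⌋`, the WINDOW PAIR WEIGHT `T_ε(ψ) = Σ_{m ≠ 0, |q_m| ≤ ε} ‖Δ_d(m)ψ‖²/L²` is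
  `≤ C ε L²` (`Δ_d(m) = Σ_x e^{-2πi m·x/L} P_x` the momentum-`q_m` `d`-wave pair field).

This support file (no new definitions, no named facts, sorry-free) records three elementary facts that
every line on this crux uses:

* §0 `wib_functionField_iff_kac`, `wib_iff_pairStructureFactor` — the two route copies agree, and the
  crux reads, by `Iff.rfl`, in the tree vocabulary of `PairFieldMomentum.lean`: the crux's inlined
  `let D := …` is `pairFieldAt dWaveFormFactor L`, its summand is `pairStructureFactor dWaveFormFactor L ψ m`
  and its window is `momentumNormSq L m ≤ ε²`.
* §1 `windowSum_le_apriori` — the A-PRIORI CEILING `T_ε(ψ) ≤ 32 L²` for EVERY Fock vector with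
  `⟨ψ, ψ⟩ = 1` (Parseval sum rule `Σ_m S_ψ(m) = Σ_x ‖P_x ψ‖²`, `sum_pairStructureFactor`, and
  `‖P_x ψ‖² ≤ 32`, from `norm_toLp_localPair_mulVec_le` with the `d`-wave constant `C_g ≤ 4√2`). Hence
  the crux is EXACTLY a factor-`ε` improvement over Parseval (`wib_shadow_apriori`: the `ε`-free shadow
  `T_ε ≤ 32L²` holds unconditionally): the `≈ ε²L²/4π` window momenta may carry at most a `Cε/32` share
  of the total pair weight — no Bragg-like pair peak `S_ψ(m) ≳ εL²` at a small nonzero momentum, no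
  `|q|^{-α}` pile-up with `α > 1`.
* §2 `wib_of_goldstoneShape` — the GOLDSTONE-SHAPE REDUCTION: a pointwise bound `S_ψ(m) · |q_m| ≤ A` on
  the punctured window `0 < |q_m| ≤ ε₀` in every sector ground state (eventually in even `L`, for all
  `U, δ`) implies the crux with `C = 32 A`, by the punctured-window lattice sum
  `Σ_{0 < |q_m| < 2ε} |q_m|⁻¹ ≤ 32 ε L²` (the landed `wls_window_sum_le` at `α = 1`). This is the
  "Goldstone shape `S_ψ(q) ≲ c/|q|`" of the item's informal statement, isolated as the pointwise content
  of the crux; every engine proposed for it so far (reflection-positivity infrared bounds à la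
  Kennedy–Lieb–Shastry; the Pitaevskii–Stringari / moment method with a torus pair-stiffness input; the
  Landau / pair-yrast floor) delivers exactly this shape — see the companion file
  `FunctionFieldCertificateWindowInfraredBoundEngines.lean`.
* §2b `not_wib_of_pairPeakWitness` (appended) — the refuter's interface: at one `(U, δ)`, sector ground
  states with a pair peak `S_ψ(m) > C|q_m|L²` at window momenta `|q_m| ≤ ε₀`, for every `C, ε₀, L₀`,
  refute the crux (test `ε := |q_m|`); a PDW at fixed `Q ≠ 0` is not a witness.

Sources: T. Kennedy, E. H. Lieb, B. S. Shastry, PRL 61 (1988) 2582 (Parseval sum rule, infrared bound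
shape); L. Pitaevskii, S. Stringari, J. Low Temp. Phys. 85 (1991) 377; D. J. Scalapino, Phys. Rep. 250
(1995) 329 §2. Everything below is folklore finite-dimensional bookkeeping over the tree's definitions.
-/

namespace Summit.HubbardSuperconductivity.HubbardSuperconductivity.Theorems

-- summit = problem name (single-conjunct summit, D-0017): `HubbardSuperconductivity` occurs twice in the path
set_option linter.dupNamespace false

open Literature.MathematicalPhysics.QuantumLattice Literature.Probability.LatticeModels Matrix Finset
open scoped ComplexOrder ComplexConjugate
open Summit.HubbardSuperconductivity.HubbardSuperconductivity.Theses

/-- The two routes state the crux verbatim: `FunctionFieldCertificate.WindowInfraredBound` and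
`KacWindowPenalty.WindowInfraredBound` are the same proposition (syntactically). [folklore] -/
theorem wib_functionField_iff_kac :
    FunctionFieldCertificate.WindowInfraredBound ↔ KacWindowPenalty.WindowInfraredBound := Iff.rfl

/-- **The crux in tree vocabulary.** The crux's `let D := fun m => Σ_x e^{-2πi(m·x)/L} • P_x` is
`pairFieldAt dWaveFormFactor L` (same body), its summand is the pair structure factor
`pairStructureFactor dWaveFormFactor L ψ m = ‖Δ_d(m)ψ‖²/L²` and its window condition is
`momentumNormSq L m ≤ ε²`; all three by `rfl`. [folklore] -/
theorem wib_iff_pairStructureFactor :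
    FunctionFieldCertificate.WindowInfraredBound ↔
      ∀ U : ℝ, 0 < U → ∀ δ ∈ Set.Ioo (0:ℝ) (1 / 2), ∃ C ε₀ : ℝ, 0 ≤ C ∧ 0 < ε₀ ∧ ∃ L₀ : ℕ,
        ∀ ε ∈ Set.Ioc (0:ℝ) ε₀, ∀ (L : ℕ) [NeZero L], L₀ ≤ L → Even L →
          ∀ ψ : Fock (Orb (FermionTorus 2 L)), star ψ ⬝ᵥ ψ = 1 →
            IsGroundStateInSector (hubbardTorus 2 L 1 U) (2 * ⌊(1 - δ) * (L : ℝ) ^ 2 / 2⌋₊) 0 ψ →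
              (∑ m : TorusSite 2 L, if m ≠ 0 ∧ momentumNormSq L m ≤ ε ^ 2 then
                  pairStructureFactor dWaveFormFactor L ψ m else 0) ≤ C * ε * (L : ℝ) ^ 2 :=
  Iff.rfl


/-! ## §1 The a-priori (Parseval) ceiling: `T_ε(ψ) ≤ 32 L²` for every normalised Fock vector -/

/-- `#unitSteps ≤ 4`. [folklore] -/
theorem wib_card_unitSteps_le_four : (unitSteps).card ≤ 4 := by
  unfold unitSteps
  exact Finset.card_le_four

/-- The local-pair norm constant `C_g = Σ_{e ∈ {0} ∪ unitSteps} 2|g e|/√2` of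
`norm_toLp_localPair_mulVec_le` is at most `4√2` for the `d`-wave form factor (`g_d(0) = 0`, four unit
steps with `|g_d| ≤ 1`). [folklore] -/
theorem wib_dWave_localPairNormBound_le :
    (∑ e ∈ insert (0 : Site 2) unitSteps, ‖((dWaveFormFactor e / Real.sqrt 2 : ℝ) : ℂ)‖ * 2) ≤
      4 * Real.sqrt 2 := by
  have h2 : (0 : ℝ) < Real.sqrt 2 := Real.sqrt_pos.2 two_pos
  -- `|g_d(e)| ≤ 1` (values `1, -1, 0`; cf. `abs_dWaveFormFactor_le_one` of the ThermalWedge support file)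
  have habs : ∀ e : Site 2, |dWaveFormFactor e| ≤ 1 := fun e => by
    unfold dWaveFormFactor
    split_ifs <;> simp
  rw [Finset.sum_insert_zero (by simp)]
  calc ∑ e ∈ unitSteps, ‖((dWaveFormFactor e / Real.sqrt 2 : ℝ) : ℂ)‖ * 2
      ≤ ∑ _e ∈ unitSteps, Real.sqrt 2 := Finset.sum_le_sum fun e _ => by
          rw [Complex.norm_real, Real.norm_eq_abs, abs_div, abs_of_pos h2, div_mul_eq_mul_div,
            div_le_iff₀ h2, Real.mul_self_sqrt zero_le_two]
          linarith [habs e]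
    _ = (unitSteps.card : ℝ) * Real.sqrt 2 := by rw [Finset.sum_const, nsmul_eq_mul]
    _ ≤ 4 * Real.sqrt 2 := by
          gcongr
          exact_mod_cast wib_card_unitSteps_le_four

/-- **`‖P_x ψ‖² ≤ 32 ‖ψ‖²`** for the `d`-wave local pair operator (`dotProduct` form):
`‖P_x ψ‖ ≤ C_g ‖ψ‖` (`norm_toLp_localPair_mulVec_le`) with `C_g ≤ 4√2`. [folklore] -/
theorem wib_re_star_localPair_mulVec_le (L : ℕ) [NeZero L] (x : TorusSite 2 L)
    (ψ : Fock (Orb (FermionTorus 2 L))) :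
    (star (localPair dWaveFormFactor L x *ᵥ ψ) ⬝ᵥ (localPair dWaveFormFactor L x *ᵥ ψ)).re ≤
      32 * (star ψ ⬝ᵥ ψ).re := by
  rw [← norm_toLp_sq_eq_re, ← norm_toLp_sq_eq_re]
  have h := norm_toLp_localPair_mulVec_le dWaveFormFactor L x ψ
  have hC := wib_dWave_localPairNormBound_le
  have hC0 := localPairNormBound_nonneg dWaveFormFactor
  set C := (∑ e ∈ insert (0 : Site 2) unitSteps, ‖((dWaveFormFactor e / Real.sqrt 2 : ℝ) : ℂ)‖ * 2)
    with hCdef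
  have h32 : C ^ 2 ≤ 32 := by
    calc C ^ 2 ≤ (4 * Real.sqrt 2) ^ 2 := pow_le_pow_left₀ hC0 hC 2
      _ = 32 := by rw [mul_pow, Real.sq_sqrt zero_le_two]; norm_num
  calc ‖(WithLp.toLp 2 (localPair dWaveFormFactor L x *ᵥ ψ) :
          EuclideanSpace ℂ (Finset (Orb (FermionTorus 2 L))))‖ ^ 2
      ≤ (C * ‖(WithLp.toLp 2 ψ : EuclideanSpace ℂ (Finset (Orb (FermionTorus 2 L))))‖) ^ 2 :=
        pow_le_pow_left₀ (norm_nonneg _) h 2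
    _ = C ^ 2 * ‖(WithLp.toLp 2 ψ : EuclideanSpace ℂ (Finset (Orb (FermionTorus 2 L))))‖ ^ 2 := by
        ring
    _ ≤ 32 * ‖(WithLp.toLp 2 ψ : EuclideanSpace ℂ (Finset (Orb (FermionTorus 2 L))))‖ ^ 2 :=
        mul_le_mul_of_nonneg_right h32 (sq_nonneg _)

/-- **Pair sum-rule ceiling**: for a normalised Fock vector, `Σ_m S_ψ(m) = Σ_x ‖P_x ψ‖² ≤ 32 L²`
(Parseval, `sum_pairStructureFactor`, and `‖P_x ψ‖² ≤ 32`). [folklore] -/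
theorem wib_sum_pairStructureFactor_le (L : ℕ) [NeZero L] (ψ : Fock (Orb (FermionTorus 2 L)))
    (hψ : star ψ ⬝ᵥ ψ = 1) :
    ∑ m, pairStructureFactor dWaveFormFactor L ψ m ≤ 32 * (L : ℝ) ^ 2 := by
  rw [sum_pairStructureFactor]
  calc ∑ x, (star (localPair dWaveFormFactor L x *ᵥ ψ) ⬝ᵥ (localPair dWaveFormFactor L x *ᵥ ψ)).re
      ≤ ∑ _x : TorusSite 2 L, (32 : ℝ) := Finset.sum_le_sum fun x _ => by
          simpa [hψ] using wib_re_star_localPair_mulVec_le L x ψ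
    _ = 32 * (L : ℝ) ^ 2 := by
          have hcard : Fintype.card (TorusSite 2 L) = L ^ 2 := by simp [ZMod.card]
          rw [Finset.sum_const, Finset.card_univ, hcard, nsmul_eq_mul]
          push_cast
          ring

/-- **The a-priori window ceiling.** For EVERY Fock vector `ψ` with `⟨ψ, ψ⟩ = 1` (no ground-state
hypothesis, any `U`, any sector) and every `ε`, the crux's window sum obeys `T_ε(ψ) ≤ 32 L²`: drop the
window, use the sum rule. So `WindowInfraredBound` is precisely a factor-`ε` improvement over Parseval —
the window holds `≈ ε²L²/4π` of the `L²` momenta and must carry at most a `Cε/32` share of the total pair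
weight. [folklore] -/
theorem windowSum_le_apriori (L : ℕ) [NeZero L] (ε : ℝ) (ψ : Fock (Orb (FermionTorus 2 L)))
    (hψ : star ψ ⬝ᵥ ψ = 1) :
    (∑ m : TorusSite 2 L, if m ≠ 0 ∧ momentumNormSq L m ≤ ε ^ 2 then
        pairStructureFactor dWaveFormFactor L ψ m else 0) ≤ 32 * (L : ℝ) ^ 2 := by
  refine le_trans (Finset.sum_le_sum fun m _ => ?_) (wib_sum_pairStructureFactor_le L ψ hψ)
  split_ifs
  exacts [le_rfl, pairStructureFactor_nonneg _ _ _ _]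

/-- **The ε-free shadow of the crux holds unconditionally**: with `C ε` replaced by the constant `32`
the window bound is true in every normalised state (in particular in every sector ground state, for all
`U`, `δ`, `ε`, `L`). Recorded to make the gap to the crux explicit. [folklore] -/
theorem wib_shadow_apriori :
    ∀ U : ℝ, 0 < U → ∀ δ ∈ Set.Ioo (0:ℝ) (1 / 2), ∀ ε : ℝ, ∀ (L : ℕ) [NeZero L],
      ∀ ψ : Fock (Orb (FermionTorus 2 L)), star ψ ⬝ᵥ ψ = 1 →
        IsGroundStateInSector (hubbardTorus 2 L 1 U) (2 * ⌊(1 - δ) * (L : ℝ) ^ 2 / 2⌋₊) 0 ψ →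
          (∑ m : TorusSite 2 L, if m ≠ 0 ∧ momentumNormSq L m ≤ ε ^ 2 then
              pairStructureFactor dWaveFormFactor L ψ m else 0) ≤ 32 * (L : ℝ) ^ 2 :=
  fun _ _ _ _ ε L _ ψ hψ _ => windowSum_le_apriori L ε ψ hψ

/-! ## §2 The Goldstone-shape reduction: `S_ψ(m)·|q_m| ≤ A` on the window ⇒ the crux with `C = 32A` -/

/-- **Window sum from the Goldstone shape (one side, one state).** If `S_ψ(m) · |q_m| ≤ A` for every
nonzero momentum label in the window `|q_m| ≤ ε₀`, then for `0 < ε ≤ ε₀` the crux's window sum is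
`≤ 32 A ε L²`: termwise `S_ψ(m) ≤ A |q_m|⁻¹`, and the punctured-window lattice sum
`Σ_{0 < |q_m| < 2ε} |q_m|⁻¹ ≤ 16 · (2ε) · L²` (`wls_window_sum_le` at `α = 1`). [folklore] -/
theorem windowSum_le_of_goldstoneShape (L : ℕ) [NeZero L] {ε ε₀ A : ℝ} (hε : 0 < ε) (hεε₀ : ε ≤ ε₀)
    (hA : 0 ≤ A) (ψ : Fock (Orb (FermionTorus 2 L)))
    (h : ∀ m : TorusSite 2 L, m ≠ 0 → momentumNormSq L m ≤ ε₀ ^ 2 →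
      pairStructureFactor dWaveFormFactor L ψ m * Real.sqrt (momentumNormSq L m) ≤ A) :
    (∑ m : TorusSite 2 L, if m ≠ 0 ∧ momentumNormSq L m ≤ ε ^ 2 then
        pairStructureFactor dWaveFormFactor L ψ m else 0) ≤ 32 * A * ε * (L : ℝ) ^ 2 := by
  rw [← Finset.sum_filter]
  set W := Finset.univ.filter (fun m : TorusSite 2 L => m ≠ 0 ∧ momentumNormSq L m ≤ ε ^ 2)
    with hW
  set W' := Finset.univ.filter (fun m : TorusSite 2 L => m ≠ 0 ∧ momentumNormSq L m < (2 * ε) ^ 2)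
    with hW'
  have hWW' : W ⊆ W' := by
    intro m hm
    rw [hW, Finset.mem_filter] at hm
    rw [hW', Finset.mem_filter]
    refine ⟨hm.1, hm.2.1, lt_of_le_of_lt hm.2.2 ?_⟩
    nlinarith
  have hterm : ∀ m ∈ W, pairStructureFactor dWaveFormFactor L ψ m ≤
      A * (momentumNormSq L m ^ ((1:ℝ) / 2))⁻¹ := by
    intro m hm
    rw [hW, Finset.mem_filter] at hm
    obtain ⟨-, hm0, hmε⟩ := hm
    have hpos : 0 < momentumNormSq L m :=
      (momentumNormSq_nonneg m).lt_of_ne' (fun h0 => hm0 ((momentumNormSq_eq_zero_iff m).1 h0))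
    have hmε₀ : momentumNormSq L m ≤ ε₀ ^ 2 := hmε.trans (pow_le_pow_left₀ hε.le hεε₀ 2)
    have hS := h m hm0 hmε₀
    rw [← Real.sqrt_eq_rpow, le_mul_inv_iff₀ (Real.sqrt_pos.2 hpos)]
    exact hS
  have hlat := wls_window_sum_le (α := (1:ℝ)) zero_le_one one_lt_two
    (by positivity : (0:ℝ) < 2 * ε) L
  have hconst : 8 * (1 + 1 / (2 - (1:ℝ))) * (2 * ε) ^ ((2:ℝ) - 1) * (L : ℝ) ^ 2 =
      32 * ε * (L : ℝ) ^ 2 := by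
    rw [show (2:ℝ) - 1 = 1 by norm_num, Real.rpow_one]
    ring
  rw [hconst] at hlat
  calc ∑ m ∈ W, pairStructureFactor dWaveFormFactor L ψ m
      ≤ ∑ m ∈ W, A * (momentumNormSq L m ^ ((1:ℝ) / 2))⁻¹ := Finset.sum_le_sum hterm
    _ ≤ ∑ m ∈ W', A * (momentumNormSq L m ^ ((1:ℝ) / 2))⁻¹ :=
        Finset.sum_le_sum_of_subset_of_nonneg hWW' fun m _ _ =>
          mul_nonneg hA (inv_nonneg.2 (Real.rpow_nonneg (momentumNormSq_nonneg m) _))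
    _ = A * ∑ m ∈ W', (momentumNormSq L m ^ ((1:ℝ) / 2))⁻¹ := by rw [Finset.mul_sum]
    _ ≤ A * (32 * ε * (L : ℝ) ^ 2) := mul_le_mul_of_nonneg_left hlat hA
    _ = 32 * A * ε * (L : ℝ) ^ 2 := by ring

/-- **The Goldstone-shape reduction of the crux.** If for all `U > 0`, `δ ∈ (0, 1/2)` there are `A ≥ 0`,
`ε₀ > 0`, `L₀` such that for every even `L ≥ L₀`, every normalised `(N_L, S^z = 0)`-sector ground state
`ψ` of `hubbardTorus 2 L 1 U` and every nonzero momentum label `m` with `|q_m| ≤ ε₀` the pair structure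
factor has the GOLDSTONE SHAPE `S_ψ(m) · |q_m| ≤ A`, then `WindowInfraredBound` holds (with `C = 32A`,
the same `ε₀`, `L₀`). This isolates the crux's content as a POINTWISE infrared bound at small nonzero
momenta; the Σ-form of the crux is recovered by the lattice sum `Σ_{0<|q|≤ε} |q|⁻¹ ≍ εL²`. (The converse
fails only by sparse spikes: the Σ-form allows finitely many window momenta with `S_ψ(m) ≫ A/|q_m|`.)
Informal source of the shape: the crux docstring ("S_ψ(q) ≲ c/|q| summed over the ≈ ε²L²/4π window
momenta"); Kennedy–Lieb–Shastry 1988 (RP infrared bound, shape `1/E(q)^{1/2}`). [folklore] -/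
theorem wib_of_goldstoneShape
    (h : ∀ U : ℝ, 0 < U → ∀ δ ∈ Set.Ioo (0:ℝ) (1 / 2), ∃ A ε₀ : ℝ, 0 ≤ A ∧ 0 < ε₀ ∧ ∃ L₀ : ℕ,
      ∀ (L : ℕ) [NeZero L], L₀ ≤ L → Even L → ∀ ψ : Fock (Orb (FermionTorus 2 L)),
        star ψ ⬝ᵥ ψ = 1 →
          IsGroundStateInSector (hubbardTorus 2 L 1 U) (2 * ⌊(1 - δ) * (L : ℝ) ^ 2 / 2⌋₊) 0 ψ →
            ∀ m : TorusSite 2 L, m ≠ 0 → momentumNormSq L m ≤ ε₀ ^ 2 →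
              pairStructureFactor dWaveFormFactor L ψ m * Real.sqrt (momentumNormSq L m) ≤ A) :
    FunctionFieldCertificate.WindowInfraredBound := by
  rw [wib_iff_pairStructureFactor]
  intro U hU δ hδ
  obtain ⟨A, ε₀, hA, hε₀, L₀, hL⟩ := h U hU δ hδ
  refine ⟨32 * A, ε₀, by positivity, hε₀, L₀, fun ε hε L _ hL₀ hev ψ hψ1 hψ => ?_⟩
  have hw := windowSum_le_of_goldstoneShape L hε.1 hε.2 hA ψ (hL L hL₀ hev ψ hψ1 hψ)
  linarith [hw]

/-! ## §2b The refuter's interface: a Bragg-type pair peak at vanishing momentum kills the crux -/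

/-- **Witness form of `¬ WindowInfraredBound`.** If at ONE `(U, δ)`, for every budget `C`, every
window `ε₀` and every `L₀`, some even `L ≥ L₀` carries a normalised `(N_L, 0)`-sector ground state `ψ`
and a nonzero momentum label `m` INSIDE the window (`|q_m| ≤ ε₀`) with
`S_ψ(m) > C · |q_m| · L²` — a super-Goldstone pair peak at vanishing momentum, e.g. `S_ψ(m_L) ≫ L` at
`|q_{m_L}| = 2π/L` (phase separation into superconducting puddles, a mesoscopic condensate, a
pair-density wave with `|Q| → 0`) — then the crux is false: test it at `ε := |q_m|`, where the window
sum is at least its single term `S_ψ(m)`. A PDW at FIXED `Q ≠ 0` is NOT a witness (`ε₀ < |Q|` escapes).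
This is the exact target a disprover's numerics / construction must hit. [folklore] -/
theorem not_wib_of_pairPeakWitness
    (h : ∃ U : ℝ, 0 < U ∧ ∃ δ ∈ Set.Ioo (0:ℝ) (1 / 2), ∀ C : ℝ, 0 ≤ C → ∀ ε₀ : ℝ, 0 < ε₀ →
      ∀ L₀ : ℕ, ∃ (L : ℕ) (_ : NeZero L), L₀ ≤ L ∧ Even L ∧
        ∃ ψ : Fock (Orb (FermionTorus 2 L)), star ψ ⬝ᵥ ψ = 1 ∧
          IsGroundStateInSector (hubbardTorus 2 L 1 U) (2 * ⌊(1 - δ) * (L : ℝ) ^ 2 / 2⌋₊) 0 ψ ∧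
            ∃ m : TorusSite 2 L, m ≠ 0 ∧ momentumNormSq L m ≤ ε₀ ^ 2 ∧
              C * Real.sqrt (momentumNormSq L m) * (L : ℝ) ^ 2 <
                pairStructureFactor dWaveFormFactor L ψ m) :
    ¬ FunctionFieldCertificate.WindowInfraredBound := by
  rw [wib_iff_pairStructureFactor]
  intro hW
  obtain ⟨U, hU, δ, hδ, hwit⟩ := h
  obtain ⟨C, ε₀, hC, hε₀, L₀, hbound⟩ := hW U hU δ hδ
  obtain ⟨L, _, hL₀, hev, ψ, hψ1, hψ, m, hm0, hmε₀, hpeak⟩ := hwit C hC ε₀ hε₀ L₀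
  have hpos : 0 < momentumNormSq L m :=
    (momentumNormSq_nonneg m).lt_of_ne' (fun h0 => hm0 ((momentumNormSq_eq_zero_iff m).1 h0))
  set ε : ℝ := Real.sqrt (momentumNormSq L m) with hε
  have hεpos : 0 < ε := Real.sqrt_pos.2 hpos
  have hεsq : ε ^ 2 = momentumNormSq L m := Real.sq_sqrt hpos.le
  have hεε₀ : ε ≤ ε₀ := by
    rw [hε, ← Real.sqrt_sq hε₀.le]
    exact Real.sqrt_le_sqrt hmε₀
  have hsum := hbound ε ⟨hεpos, hεε₀⟩ L hL₀ hev ψ hψ1 hψ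
  -- the window sum at `ε = |q_m|` contains the term `m`
  have hterm : pairStructureFactor dWaveFormFactor L ψ m ≤
      ∑ m' : TorusSite 2 L, if m' ≠ 0 ∧ momentumNormSq L m' ≤ ε ^ 2 then
        pairStructureFactor dWaveFormFactor L ψ m' else 0 := by
    have hm : (if m ≠ 0 ∧ momentumNormSq L m ≤ ε ^ 2 then
        pairStructureFactor dWaveFormFactor L ψ m else 0) =
        pairStructureFactor dWaveFormFactor L ψ m := if_pos ⟨hm0, hεsq.symm.le⟩
    rw [← hm]
    exact Finset.single_le_sum (f := fun m' => if m' ≠ 0 ∧ momentumNormSq L m' ≤ ε ^ 2 then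
        pairStructureFactor dWaveFormFactor L ψ m' else 0)
      (fun m' _ => by
        split_ifs
        exacts [pairStructureFactor_nonneg _ _ _ _, le_rfl])
      (Finset.mem_univ m)
  linarith [hterm, hsum, hpeak]

end Summit.HubbardSuperconductivity.HubbardSuperconductivity.Theorems
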